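import Summits.AnomalousDissipation.AnomalousDissipation.Theorems.TaylorGreenLogLoudStates.Negative.LoadBearing

/-!
# Negative knowledge for the crux `TaylorGreenLogLoudStates` (stmt-AnomalousDissipation-14586, route MirrorVariety), III:
# the eigenforce work identity and the transfer window of a witness

Certified copy of §2(g) of the cdisprove work file `Cruxes/TaylorGreenLogLoudStates/Disproof.lean`
(refuter-cdisprove-stmt-AnomalousDissipation-14586-0, cycle 2). Supports stmt-AnomalousDissipation-14586; no positive
route-item statement is asserted. `f_TG` is a Stokes eigenfield (`Δf_TG = −12π²f_TG`) with `∫|f_TG|² = ¼`, admissible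
as a test at every `N ≥ 2`; testing the Galerkin equations with it pins the cubic transfer out of the forcing shell.

* `mem_puncturedBall_of_mem_tgShell`, `isBandLimited_tgForce` (`N ≥ 2`), `laplacian_tgForce_eq`,
  `integral_inner_laplacian_tgForce` (`∫⟪U, Δf_TG⟫ = −12π²∫⟪f_TG, U⟫`).
* `eigenforce_identity` — `12π²ν ∫⟪f_TG, U⟫ = ¼ + ∫⟪U, (U·∇)f_TG⟫` for every admissible TG state at `N ≥ 2` (the first
  half of the route's support item `EigenforceWorkIdentity`, stmt-14587, whose second half is the sibling
  `energy_identity`; proved here as the tool behind the negative lemmas below — the item itself is a prover's landing).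
* `transfer_window` — every log-loud witness state has `−¼ + 12π²νc ≤ ∫⟪U,(U·∇)f_TG⟫ ≤ −¼ + 6π²ν√(E log(1/ν))`.
* `sqrt_le_one_add_abs`, `tendsto_mul_sqrt_log` (`ν_j√(E log(1/ν_j)) → 0`), `not_logLoud_with_transfer_gap` — the
  natural strengthening "transfer functional `≥ −¼ + δ` for a fixed `δ > 0`" is FALSE.
-/

noncomputable section

open scoped InnerProductSpace Topology
open MeasureTheory Filter
open Literature.Analysis.FunctionSpaces Literature.Analysis.FunctionSpaces.Torus
open Summit.AnomalousDissipation.AnomalousDissipation.Theorems.TaylorGreenLoudGalerkinStates.Negative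

namespace Summit.AnomalousDissipation.AnomalousDissipation.Theorems.TaylorGreenLogLoudStates.Negative

/-! ### (g) The eigenforce work identity and the transfer window of a witness

`f_TG` is a Stokes eigenfield (`Δ f_TG = −12π² f_TG`, shell `|k|² = 3`) with `∫|f_TG|² = ¼`, admissible as a TEST at
every resolution `N ≥ 2`. Testing the Galerkin equations with `a := f_TG` gives the EIGENFORCE WORK IDENTITY
`12π²ν ∫⟪f_TG, U⟫ = ¼ + ∫⟪U, (U·∇)f_TG⟫` (route item `EigenforceWorkIdentity`, stmt-14587 — a POSITIVE support item:
proved here as a tool, attached as evidence for a prover, not landed on the negative lane), whence the transfer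
functional `T(U) = ∫⟪U,(U·∇)f_TG⟫` of every witness sits in the window
`[−¼ + 12π²ν c, −¼ + 6π²ν√(E log(1/ν))]`, i.e. `T(U) → −¼` at rate `O(ν√log(1/ν))`: the nonlinear flux out of the
forcing shell of a witness is pinned, NOT an obstruction (`|T(U)| ≤ ‖∇f_TG‖_∞ ∫|U|²` is far from saturated). -/

/-- The TG shell lies in the punctured ball of every resolution `N ≥ 2` (`0 ≠ k`, `|k|² = 3 ≤ 4 ≤ N²`). [folklore] -/
theorem mem_puncturedBall_of_mem_tgShell {N : ℕ} (hN : 2 ≤ N) {k : Fin 3 → ℤ} (hk : k ∈ tgShell) :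
    k ∈ (freqBall N).erase 0 := by
  refine Finset.mem_erase.2 ⟨fun h => zero_not_mem_tgShell (h ▸ hk), mem_freqBall.2 ?_⟩
  rw [freqNormSq_of_mem_tgShell hk]
  have h2 : (2 : ℝ) ≤ N := by exact_mod_cast hN
  nlinarith

/-- `f_TG` is band-limited to the punctured ball at every resolution `N ≥ 2`. [folklore] -/
theorem isBandLimited_tgForce {N : ℕ} (hN : 2 ≤ N) : IsBandLimited N tgForce := by
  intro k hk
  rw [mFourierCoeff_tgForce, if_neg]
  exact fun hmem => hk (mem_puncturedBall_of_mem_tgShell hN hmem)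

/-- **`f_TG` is a Stokes eigenfield**: `Δ f_TG = realTrigPoly tgShell (−12π² • f̂)` (`|k|² = 3` on the shell). [folklore] -/
theorem laplacian_tgForce_eq :
    laplacian tgForce = realTrigPoly tgShell ((-(12 * Real.pi ^ 2) : ℝ) • tgCoeff) := by
  funext x
  rw [tgForce_eq_realTrigPoly, laplacian_realTrigPoly]
  refine congrFun (realTrigPoly_congr fun k hk => ?_) x
  rw [freqNormSq_of_mem_tgShell hk, Pi.smul_apply, ← Complex.coe_smul, ← neg_smul]
  congr 1
  push_cast
  ring

/-- `∫⟪U, Δ f_TG⟫ = −12π² ∫⟪f_TG, U⟫` for `U ∈ L²`. [folklore] -/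
theorem integral_inner_laplacian_tgForce {U : UnitAddTorus (Fin 3) → EuclideanSpace ℝ (Fin 3)}
    (hU : MemLp U 2 volume) :
    ∫ x, ⟪U x, laplacian tgForce x⟫_ℝ = -(12 * Real.pi ^ 2) * ∫ x, ⟪tgForce x, U x⟫_ℝ := by
  rw [laplacian_tgForce_eq, integral_inner_realTrigPoly_right neg_mem_tgShell (isConjSymm_tgCoeff.real_smul _) hU,
    integral_inner_tgForce_eq_sum hU, Finset.mul_sum]
  refine Finset.sum_congr rfl fun k _ => ?_
  rw [Pi.smul_apply, ← Complex.coe_smul, inner_smul_right, Complex.re_ofReal_mul, ← inner_conj_symm, Complex.conj_re]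

/-- **Eigenforce work identity** (= route item `EigenforceWorkIdentity`, first half; the second half is the sibling
`energy_identity`): every admissible Taylor–Green state at resolution `N ≥ 2` satisfies
`12π²ν ∫⟪f_TG, U⟫ = ¼ + ∫⟪U, (U·∇)f_TG⟫`. [folklore] -/
theorem eigenforce_identity {ν : ℝ} {N : ℕ} (hN : 2 ≤ N) {U : UnitAddTorus (Fin 3) → EuclideanSpace ℝ (Fin 3)}
    (hU : IsSteadyState ν N tgForce U) :
    12 * Real.pi ^ 2 * ν * ∫ x, ⟪tgForce x, U x⟫_ℝ = 1 / 4 + ∫ x, ⟪U x, convect U tgForce x⟫_ℝ := by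
  obtain ⟨hs, hdiv, -, hband, htest⟩ := hU
  have h := htest tgForce isSmooth_tgForce isDivFree_tgForce (isBandLimited_tgForce hN)
  have hmem : MemLp U 2 volume := hs.continuous.memLp_of_hasCompactSupport (HasCompactSupport.of_compactSpace _)
  have i1 : Integrable (fun x => ⟪U x, convect U tgForce x⟫_ℝ) volume :=
    (hs.inner (hs.convect isSmooth_tgForce)).integrable
  have i2 : Integrable (fun x => ν * ⟪U x, laplacian tgForce x⟫_ℝ) volume :=
    (hs.inner isSmooth_tgForce.laplacian).integrable.const_mul ν
  have i3 : Integrable (fun x => ⟪tgForce x, tgForce x⟫_ℝ) volume :=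
    (continuous_tgForce.inner continuous_tgForce).integrable_unitAddTorus
  have i12 : Integrable (fun x => ⟪U x, convect U tgForce x⟫_ℝ + ν * ⟪U x, laplacian tgForce x⟫_ℝ) volume :=
    i1.add i2
  rw [integral_add i12 i3, integral_add i1 i2, integral_const_mul, integral_inner_laplacian_tgForce hmem] at h
  have h4 : ∫ x, ⟪tgForce x, tgForce x⟫_ℝ = 4⁻¹ := by
    simp_rw [real_inner_self_eq_norm_sq]
    exact integral_norm_sq_tgForce
  rw [h4] at h
  linarith

/-- **Transfer window of a witness.** For a log-loud admissible state at `(ν, N)`, `N ≥ 2`, `ν ≥ 0`: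
`−¼ + 12π²νc ≤ ∫⟪U,(U·∇)f_TG⟫ ≤ −¼ + 6π²ν√(E log(1/ν))` — the cubic transfer functional tends to `−¼`. [folklore] -/
theorem transfer_window {ν E c : ℝ} {N : ℕ} (hN : 2 ≤ N) (hν : 0 ≤ ν)
    {U : UnitAddTorus (Fin 3) → EuclideanSpace ℝ (Fin 3)} (hU : IsSteadyState ν N tgForce U)
    (hE : ∫ x, ‖U x‖ ^ 2 ≤ E * Real.log (1 / ν)) (hloud : c ≤ ν * gradNormSq U) :
    -(1 / 4) + 12 * Real.pi ^ 2 * ν * c ≤ ∫ x, ⟪U x, convect U tgForce x⟫_ℝ ∧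
      ∫ x, ⟪U x, convect U tgForce x⟫_ℝ ≤ -(1 / 4) + 6 * Real.pi ^ 2 * ν * Real.sqrt (E * Real.log (1 / ν)) := by
  have hid := eigenforce_identity hN hU
  have hen := energy_identity hU continuous_tgForce
  have h1 := loudness_le_half_sqrt_energy hU
  have h2 : Real.sqrt (∫ x, ‖U x‖ ^ 2) ≤ Real.sqrt (E * Real.log (1 / ν)) := Real.sqrt_le_sqrt hE
  have hπν : 0 ≤ 12 * Real.pi ^ 2 * ν := by positivity
  constructor
  · have h3 : c ≤ ∫ x, ⟪tgForce x, U x⟫_ℝ := hloud.trans_eq hen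
    nlinarith [mul_le_mul_of_nonneg_left h3 hπν]
  · have h3 : ∫ x, ⟪tgForce x, U x⟫_ℝ ≤ 2⁻¹ * Real.sqrt (E * Real.log (1 / ν)) := by
      rw [← hen]
      linarith
    nlinarith [mul_le_mul_of_nonneg_left h3 hπν]

/-- `√y ≤ 1 + |y|` for every real `y`. [folklore] -/
theorem sqrt_le_one_add_abs (y : ℝ) : Real.sqrt y ≤ 1 + |y| := by
  rw [Real.sqrt_le_left (by positivity)]
  nlinarith [le_abs_self y, abs_nonneg y]

/-- `ν_j √(E log(1/ν_j)) → 0` along `0 < ν_j ≤ 1/4`, `ν_j → 0`. [folklore] -/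
theorem tendsto_mul_sqrt_log {ν : ℕ → ℝ} (hν : ∀ j, 0 < ν j ∧ ν j ≤ 1 / 4) (hlim : Tendsto ν atTop (𝓝 0)) (E : ℝ) :
    Tendsto (fun j => ν j * Real.sqrt (E * Real.log (1 / ν j))) atTop (𝓝 0) := by
  have hup : Tendsto (fun j => ν j * (1 + |E| * Real.log (1 / ν j))) atTop (𝓝 0) := by
    have h1 : Tendsto (fun j => ν j + |E| * (ν j * Real.log (1 / ν j))) atTop (𝓝 (0 + |E| * 0)) :=
      hlim.add (tendsto_const_nhds.mul (tendsto_mul_log_one_div hlim))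
    rw [mul_zero, add_zero] at h1
    refine h1.congr fun j => ?_
    ring
  refine tendsto_of_tendsto_of_tendsto_of_le_of_le tendsto_const_nhds hup (fun j => ?_) fun j => ?_
  · exact mul_nonneg (hν j).1.le (Real.sqrt_nonneg _)
  · refine mul_le_mul_of_nonneg_left ?_ (hν j).1.le
    have hlog := (log_one_div_pos (hν j).1 (hν j).2).le
    calc Real.sqrt (E * Real.log (1 / ν j)) ≤ 1 + |E * Real.log (1 / ν j)| := sqrt_le_one_add_abs _
      _ = 1 + |E| * Real.log (1 / ν j) := by rw [abs_mul, abs_of_nonneg hlog]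

/-- **Natural strengthening refuted: a transfer gap.** No witness of the log crux can keep the transfer functional
`∫⟪U,(U·∇)f_TG⟫` of its states `≥ −¼ + δ` for a fixed `δ > 0` (at all `j`, eventually in `N`): the window closes at
rate `6π²ν_j√(E log(1/ν_j)) → 0`. Dually it is `≥ −¼ + 12π²ν_jc > −¼` always. [folklore] -/
theorem not_logLoud_with_transfer_gap :
    ¬ ∃ (ν : ℕ → ℝ) (E c δ : ℝ), (∀ j, 0 < ν j ∧ ν j ≤ 1 / 4) ∧ Tendsto ν atTop (𝓝 0) ∧ 0 < c ∧ 0 < δ ∧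
        ∀ j, ∀ᶠ N in atTop, ∃ U : UnitAddTorus (Fin 3) → EuclideanSpace ℝ (Fin 3),
          IsSteadyState (ν j) N tgForce U ∧ ∫ x, ‖U x‖ ^ 2 ≤ E * Real.log (1 / ν j) ∧ c ≤ ν j * gradNormSq U ∧
            -(1 / 4) + δ ≤ ∫ x, ⟪U x, convect U tgForce x⟫_ℝ := by
  rintro ⟨ν, E, c, δ, hν, hlim, -, hδ, h⟩
  have hb : ∀ j, δ ≤ 6 * Real.pi ^ 2 * (ν j * Real.sqrt (E * Real.log (1 / ν j))) := by
    intro j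
    obtain ⟨N, ⟨U, hU, hE, hloud, hgap⟩, hN⟩ := ((h j).and (eventually_ge_atTop 2)).exists
    have hw := (transfer_window hN (hν j).1.le hU hE hloud).2
    nlinarith [hw, hgap]
  have hT : Tendsto (fun j => 6 * Real.pi ^ 2 * (ν j * Real.sqrt (E * Real.log (1 / ν j)))) atTop
      (𝓝 (6 * Real.pi ^ 2 * 0)) := tendsto_const_nhds.mul (tendsto_mul_sqrt_log hν hlim E)
  rw [mul_zero] at hT
  have : δ ≤ 0 := ge_of_tendsto' hT hb
  linarith

end Summit.AnomalousDissipation.AnomalousDissipation.Theorems.TaylorGreenLogLoudStates.Negative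

end
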